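import Literature.AlgebraicGeometry.HodgeTheory.AlgebraicityLocus
import Literature.AlgebraicGeometry.HodgeTheory.AlgebraicityLocusCurveBaseDichotomy
import Literature.AlgebraicGeometry.HodgeTheory.ComplementDeathConstantRationalOpenPieces
import Literature.AlgebraicGeometry.HodgeTheory.GenericComplexPointsOverCountableFields
import Literature.AlgebraicGeometry.HodgeTheory.GenericFibreClosedSubsetSpreadSmoothBase
import Literature.AlgebraicGeometry.HodgeTheory.HodgeGenericQbarDescentProofs
import Literature.AlgebraicGeometry.HodgeTheory.HodgeLocus
import Literature.AlgebraicGeometry.HodgeTheory.InvariantClassesFromTotalSpaceCurveBase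
import Literature.AlgebraicGeometry.HodgeTheory.IsoTransport
import Literature.AlgebraicGeometry.HodgeTheory.QbarFamilyLocalSystem
import Literature.AlgebraicGeometry.HodgeTheory.QuasiProjectiveOfAffine
import Literature.AlgebraicGeometry.HodgeTheory.SpreadSliceCodimension
import Literature.AlgebraicGeometry.HodgeTheory.SupportedHodgeClassesAlgebraic
import Literature.AlgebraicGeometry.Motives.BaseChange
import Literature.AlgebraicGeometry.Motives.BaseChangeAlgebraicExtension
import Literature.AlgebraicGeometry.Motives.BaseChangeHomDescent
import Literature.AlgebraicGeometry.Motives.ComplexPointsManifold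
import Literature.AlgebraicGeometry.Motives.DominantImageUncountable
import Literature.AlgebraicGeometry.Motives.FamiliesVHS
import Literature.AlgebraicGeometry.Motives.VarietiesDimensionProofs
import HarnessLib

/-!
# Smooth projective families descended to a countable field: fibres along isomorphisms of families,
# curve bases, the `k`-form of the base and complex points over its generic point

Bookkeeping for the propagation of algebraicity along the `k`-structure of a family (Voisin, *Hodge Theory II*,
§3.3.1; Charles–Schnell 2014, proof of Prop. 11.3.11 and Lemma 11.3.14 "generic complex points").  Setting: a field
`k` (countable where stated), `σ : k →+* ℂ`, a family `f₀ : 𝒳₀ ⟶ S₀` of `k`-schemes and its complexification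
`f = (baseChangeHom σ).map f₀ : 𝒳 ⟶ S`.

Part 1 (isomorphic families): for an isomorphism of families `(e𝒳, eS) : f' ≅ f`, every fibre of `f'` is
isomorphic to a fibre of `f` compatibly with the fibre inclusions (`exists_fiberIso_of_arrowIso`,
`left_eq_of_arrowIso`), smooth projective families transport (`IsSmoothProjectiveFamily.of_arrowIso`), and so do
the restrictions of a global class to the fibres, their rationality / Hodge type / algebraicity
(`map_fiberι_of_fiberIso`, `fibrewise_rational_hodgeType_of_arrowIso`, `map_fiberι_mem_algebraicClasses_iff_of_arrowIso`)
and the standing hypotheses on the base (`base_hypotheses_of_iso`: irreducible, affine, smooth over `ℂ`,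
topological Krull dimension `1`).
Part 2 (curve bases): an irreducible scheme smooth over `ℂ` of topological Krull dimension `1` is smooth of relative
dimension `1` (`smoothOfRelativeDimension_one_of_topologicalKrullDim`).
Part 3 (the `k`-form of the base): `Spec ℂ → Spec k` is surjective, flat and quasi-compact
(`surjective_flat_quasiCompact_specMap`); if `S₀ ⊗_σ ℂ` is smooth over `ℂ` then `S₀` is locally of finite type
(`locallyOfFiniteType_of_smooth_baseChangeHom`, fpqc descent, Görtz–Wedhorn 14.51 / EGA IV₂ 2.7.1); if it is
irreducible so is `S₀` (`irreducibleSpace_of_baseChangeHom`); a complex point lying in no proper subset defined over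
`σ(k)` lies over the generic point of `S₀` (`base_pt_eq_genericPoint_of_isGenericPoint`), with converse for `k`
countable (`isGenericPoint_iff_base_pt_eq_genericPoint`, Lang's C4 ⇒ C7); an irreducible scheme smooth over `ℂ` is
integral (`isIntegral_of_irreducibleSpace_of_smooth`).
Part 4 (helpers): quasi-projectivity over `ℂ` is invariant under isomorphisms (`isQuasiProjectiveOver_of_iso`); a
complex point whose image in `S₀` is dense lies over the generic point (`base_pt_eq_genericPoint_of_closure_eq`).
Part 5: a complex point over the generic point of `S₀` stays over the generic point of `S₀ ⊗_{σ'} k'` for an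
integral extension `τ ∘ σ' = σ` (`closure_base_pt_eq_univ_of_factor`; incomparability, Atiyah–Macdonald Cor. 5.9).

Theorems only: no definition, no named fact.  All in the namespace
`Literature.AlgebraicGeometry.HodgeTheory.AlgebraicityLocusPropagation`.

Provenance: Literature home of the fact-free bookkeeping sections of the Summits-side
`HodgeConjecture/Theorems/AnchorTransportVariationalHodgePadicDescent` (§§ArrowIso, Complex),
`…/Ring2HypothesesFlatSectionsVHCCurveBase` (§1), `…/AnchorTransportVariationalHodgePadicGenericPropagation` (§Base),
`…/AnchorTransportVariationalHodgePadicUncountablePropagation` (§Helpers) and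
`…/AnchorTransportVariationalHodgePadicGenericPropagationQP` (`closure_base_pt_eq_univ_of_factor`), whose imports are
`Literature/` and Mathlib; re-homed so that the structure theorem on algebraicity loci
(`HodgeTheory/AlgebraicityLocusQbarClosedHolds`) can be proved Literature-side. Lane `lit-hodgefound`, seat p20.

## References
* [CharlesSchnell2014Notes] F. Charles, C. Schnell, *Notes on absolute Hodge classes* (2014), §11.3: Prop. 11.3.11
  (proof), Lemma 11.3.14.
* [VoisinHodgeII2003] C. Voisin, *Hodge Theory and Complex Algebraic Geometry II* (2003), §3.3.1.
* [GortzWedhorn2020] U. Görtz, T. Wedhorn, *Algebraic Geometry I* (2nd ed., 2020), Prop. 14.51, App. B.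
* [Lang1958IAG] S. Lang, *Introduction to Algebraic Geometry* (1958), Ch. II §3, Ch. III §4.
* [AtiyahMacdonald1969] M. Atiyah, I. Macdonald, *Introduction to Commutative Algebra* (1969), Cor. 5.9.
* [Hartshorne1977] R. Hartshorne, *Algebraic Geometry* (1977), II §3.
-/

noncomputable section

namespace Literature.AlgebraicGeometry.HodgeTheory.AlgebraicityLocusPropagation

/-! ## Part 1: Fibres and fibrewise data along an isomorphism of families -/

section Part1

open _root_.CategoryTheory _root_.CategoryTheory.Limits _root_.AlgebraicGeometry TopologicalSpace
open Literature.AlgebraicGeometry.Motives Literature.AlgebraicGeometry.HodgeTheory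
open Literature.AlgebraicGeometry.Limits

universe u

/-! ### Fibres of isomorphic families -/

section ArrowIso

variable {k : Type u} [Field k] {𝒳 S 𝒳' S' : SchemeOver k} {f : 𝒳 ⟶ S} {f' : 𝒳' ⟶ S'}
  (e𝒳 : 𝒳' ≅ 𝒳) (eS : S' ≅ S) (comm : f' ≫ eS.hom = e𝒳.hom ≫ f)

include comm in
/-- The underlying scheme morphisms of an isomorphism of families: `f' = e𝒳 ≫ f ≫ eS⁻¹`. [cite: CharlesSchnell2014Notes, Prop. 11.3.11 (proof), auxiliary step] -/
theorem left_eq_of_arrowIso : f'.left = e𝒳.hom.left ≫ f.left ≫ eS.inv.left := by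
  have h := congrArg (fun φ => (φ ≫ eS.inv).left) comm
  simpa using h

include comm in
/-- **Fibres of isomorphic families are isomorphic, compatibly with the fibre inclusions.** For an
isomorphism of families `(e𝒳, eS) : f' ≅ f` over `k` and points `s' ∈ S'(k)`, `s = eS(s') ∈ S(k)`,
there is an isomorphism `φ : 𝒳'_{s'} ≅ 𝒳_s` of `k`-schemes with `φ ≫ (𝒳_s ↪ 𝒳) = (𝒳'_{s'} ↪ 𝒳') ≫ e𝒳`
(both fibres are the fibre product of `f` along `Spec k → S`). [cite: CharlesSchnell2014Notes, Prop. 11.3.11 (proof), auxiliary step] -/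
theorem exists_fiberIso_of_arrowIso {s' : AlgPoints S' k} {s : AlgPoints S k}
    (hs : AlgPoints.map eS.hom s' = s) :
    ∃ φ : fiberOver f' s' ≅ fiberOver f s, φ.hom ≫ fiberι f s = fiberι f' s' ≫ e𝒳.hom := by
  subst hs
  have Q' : IsPullback (fiberι f' s').left (fiberOverToSpec f' s').left f'.left s'.left :=
    IsPullback.of_hasPullback f'.left s'.left
  have Q₂ : IsPullback (fiberι f (AlgPoints.map eS.hom s')).left
      (fiberOverToSpec f (AlgPoints.map eS.hom s')).left f.left (AlgPoints.map eS.hom s').left :=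
    IsPullback.of_hasPullback f.left (AlgPoints.map eS.hom s').left
  have hf' : f'.left ≫ eS.hom.left = e𝒳.hom.left ≫ f.left := by
    have h := congrArg CommaMorphism.left comm
    simpa using h
  have Q : IsPullback ((fiberι f' s').left ≫ e𝒳.hom.left) (fiberOverToSpec f' s').left f.left
      (AlgPoints.map eS.hom s').left := by
    refine Q'.of_iso (Iso.refl _) ((Over.forget _).mapIso e𝒳) (Iso.refl _) ((Over.forget _).mapIso eS)
      ?_ ?_ ?_ ?_
    · simp
    · simp
    · simpa using hf'
    · change s'.left ≫ eS.hom.left = 𝟙 _ ≫ (s' ≫ eS.hom).left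
      simp
  refine ⟨Over.isoMk (Q.isoIsPullback _ _ Q₂) ?_, ?_⟩
  · change (Q.isoIsPullback _ _ Q₂).hom ≫ (fiberι f (AlgPoints.map eS.hom s')).left ≫ 𝒳.hom =
      (fiberι f' s').left ≫ 𝒳'.hom
    rw [← Category.assoc, IsPullback.isoIsPullback_hom_fst, Category.assoc, Over.w e𝒳.hom]
  · ext : 1
    change (Q.isoIsPullback _ _ Q₂).hom ≫ (fiberι f (AlgPoints.map eS.hom s')).left =
      (fiberι f' s').left ≫ e𝒳.hom.left
    exact Q.isoIsPullback_hom_fst _ _ Q₂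

include comm in
/-- **Smooth projective families transport along isomorphisms of families**: smoothness of relative
dimension `n` and properness respect isomorphisms, and every fibre of `f'` is isomorphic to a fibre of
`f` (`exists_fiberIso_of_arrowIso`, `IsSmoothProjective.of_iso`). [cite: CharlesSchnell2014Notes, Prop. 11.3.11 (proof), auxiliary step] -/
theorem IsSmoothProjectiveFamily.of_arrowIso {n : ℕ} (hf : IsSmoothProjectiveFamily f n) :
    IsSmoothProjectiveFamily f' n := by
  have hl := left_eq_of_arrowIso e𝒳 eS comm
  haveI : IsIso e𝒳.hom.left := by
    change IsIso ((Over.forget _).map e𝒳.hom)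
    infer_instance
  haveI : IsIso eS.inv.left := by
    change IsIso ((Over.forget _).map eS.inv)
    infer_instance
  refine ⟨?_, ?_, fun s' => ?_⟩
  · rw [hl]
    exact (MorphismProperty.cancel_left_of_respectsIso (@SmoothOfRelativeDimension n) _ _).mpr
      ((MorphismProperty.cancel_right_of_respectsIso (@SmoothOfRelativeDimension n) _ _).mpr
        hf.smoothOfRelativeDimension)
  · rw [hl]
    exact (MorphismProperty.cancel_left_of_respectsIso (@IsProper) _ _).mpr
      ((MorphismProperty.cancel_right_of_respectsIso (@IsProper) _ _).mpr hf.isProper)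
  · obtain ⟨φ, -⟩ := exists_fiberIso_of_arrowIso e𝒳 eS comm (s' := s') rfl
    exact (hf.isSmoothProjective _).of_iso φ.symm

end ArrowIso

/-! ### Transport of fibrewise data along an isomorphism of complex families -/

section Complex

variable {𝒳 S 𝒳' S' : SchemeOver ℂ} {f : 𝒳 ⟶ S} {f' : 𝒳' ⟶ S'}
  (e𝒳 : 𝒳' ≅ 𝒳) (eS : S' ≅ S)

/-- **Restrictions to the fibres of an isomorphic family**: for `φ : 𝒳'_{s'} ≅ 𝒳_s` compatible with
the fibre inclusions, `(e𝒳^* A)|_{𝒳'_{s'}} = φ^* (A|_{𝒳_s})`. [cite: CharlesSchnell2014Notes, Prop. 11.3.11 (proof), auxiliary step] -/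
theorem map_fiberι_of_fiberIso {s' : ComplexPoints S'} {s : ComplexPoints S}
    (φ : fiberOver f' s' ≅ fiberOver f s) (hφ : φ.hom ≫ fiberι f s = fiberι f' s' ≫ e𝒳.hom)
    (i : ℕ) (A : complexBetti 𝒳 i) :
    complexBetti.map (fiberι f' s') i (complexBetti.map e𝒳.hom i A) =
      complexBetti.map φ.hom i (complexBetti.map (fiberι f s) i A) := by
  rw [← CategoryTheory.comp_apply, ← complexBetti.map_comp, ← CategoryTheory.comp_apply,
    ← complexBetti.map_comp, hφ]

/-- **The fibrewise hypotheses move along an isomorphism of families**: if every `A|_{𝒳_s}` is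
rational of Hodge type `(p, p)` (fibres of relative dimension `n`), so is every `(e𝒳^* A)|_{𝒳'_{s'}}`
(`isRationalClass_map_iff_of_iso`, `isOfHodgeType_map_iff_of_iso`). [cite: CharlesSchnell2014Notes, Prop. 11.3.11 (proof), auxiliary step] -/
theorem fibrewise_rational_hodgeType_of_arrowIso (comm : f' ≫ eS.hom = e𝒳.hom ≫ f) {n p : ℕ}
    (A : complexBetti 𝒳 (2 * p))
    (hA : ∀ s : ComplexPoints S, IsRationalClass (complexBetti.map (fiberι f s) (2 * p) A) ∧
      IsOfHodgeType n (fiberOver f s) (2 * p) p p (complexBetti.map (fiberι f s) (2 * p) A))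
    (s' : ComplexPoints S') :
    IsRationalClass (complexBetti.map (fiberι f' s') (2 * p) (complexBetti.map e𝒳.hom (2 * p) A)) ∧
      IsOfHodgeType n (fiberOver f' s') (2 * p) p p
        (complexBetti.map (fiberι f' s') (2 * p) (complexBetti.map e𝒳.hom (2 * p) A)) := by
  obtain ⟨φ, hφ⟩ := exists_fiberIso_of_arrowIso e𝒳 eS comm (s' := s') rfl
  rw [map_fiberι_of_fiberIso e𝒳 φ hφ]
  exact ⟨(isRationalClass_map_iff_of_iso φ).mpr (hA _).1,
    (isOfHodgeType_map_iff_of_iso φ).mpr (hA _).2⟩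

/-- **Algebraicity of the restrictions is invariant along an isomorphism of families**:
`(e𝒳^* A)|_{𝒳'_{s'}}` is algebraic iff `A|_{𝒳_{eS s'}}` is (`mem_algebraicClasses_map_iff_of_iso`
along the isomorphism of fibres). [cite: CharlesSchnell2014Notes, Prop. 11.3.11 (proof), auxiliary step] -/
theorem map_fiberι_mem_algebraicClasses_iff_of_arrowIso (comm : f' ≫ eS.hom = e𝒳.hom ≫ f) {p : ℕ}
    (A : complexBetti 𝒳 (2 * p)) {s' : ComplexPoints S'} {s : ComplexPoints S}
    (hs : AlgPoints.map eS.hom s' = s) :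
    complexBetti.map (fiberι f' s') (2 * p) (complexBetti.map e𝒳.hom (2 * p) A) ∈
        algebraicClasses (fiberOver f' s') p ↔
      complexBetti.map (fiberι f s) (2 * p) A ∈ algebraicClasses (fiberOver f s) p := by
  obtain ⟨φ, hφ⟩ := exists_fiberIso_of_arrowIso e𝒳 eS comm hs
  rw [map_fiberι_of_fiberIso e𝒳 φ hφ]
  exact mem_algebraicClasses_map_iff_of_iso φ

include eS in
/-- **The hypotheses on the base move along an isomorphism of bases**: irreducibility, affineness,
smoothness over `ℂ` and topological Krull dimension are invariant under `eS : S' ≅ S`. [cite: CharlesSchnell2014Notes, Prop. 11.3.11 (proof), auxiliary step] -/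
theorem base_hypotheses_of_iso [IrreducibleSpace S.left] [IsAffine S.left]
    [AlgebraicGeometry.Smooth S.hom] (hdim : topologicalKrullDim S.left = 1) :
    IrreducibleSpace S'.left ∧ IsAffine S'.left ∧ AlgebraicGeometry.Smooth S'.hom ∧
      topologicalKrullDim S'.left = 1 := by
  haveI : IsIso eS.hom.left := by
    change IsIso ((Over.forget _).map eS.hom)
    infer_instance
  let h : S'.left ≃ₜ S.left := Scheme.homeoOfIso (asIso eS.hom.left)
  refine ⟨h.irreducibleSpace_iff.mpr inferInstance, IsAffine.of_isIso eS.hom.left, ?_, ?_⟩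
  · rw [← Over.w eS.hom]
    exact (MorphismProperty.cancel_left_of_respectsIso (@AlgebraicGeometry.Smooth) _ _).mpr
      inferInstance
  · rw [IsHomeomorph.topologicalKrullDim_eq _ h.isHomeomorph, hdim]

end Complex

end Part1

/-! ## Part 2: Curve bases: relative dimension `1` -/

section Part2

open _root_.CategoryTheory _root_.AlgebraicGeometry _root_.Topology Filter
open Literature.AlgebraicGeometry Literature.AlgebraicGeometry.Motives Literature.AlgebraicGeometry.HodgeTheory

/-! ## Curve bases: relative dimension `1` -/

/-- **A smooth irreducible `ℂ`-scheme of topological Krull dimension `1` is smooth of relative dimension `1`**: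
`S(ℂ)` is connected (`S` irreducible), so `S` is smooth of SOME relative dimension `d`
(`exists_smoothOfRelativeDimension_of_connectedSpace_complexPoints`), and `dim S = d`
(`Motives.topologicalKrullDim_eq_of_smoothOfRelativeDimension`). [cite: GortzWedhorn2020, Lemma 6.26 and Thm. 6.28] -/
theorem smoothOfRelativeDimension_one_of_topologicalKrullDim (S : SchemeOver ℂ) [IrreducibleSpace S.left]
    [AlgebraicGeometry.Smooth S.hom] (hdim : topologicalKrullDim S.left = 1) :
    SmoothOfRelativeDimension 1 S.hom := by
  haveI : LocallyOfFiniteType S.hom := inferInstance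
  haveI : ConnectedSpace (ComplexPoints S) := (ComplexPoints.connectedSpace_iff_holds S).2 inferInstance
  obtain ⟨d, hd⟩ := exists_smoothOfRelativeDimension_of_connectedSpace_complexPoints S
  haveI := hd
  have h := Motives.topologicalKrullDim_eq_of_smoothOfRelativeDimension S.hom d
  rw [hdim] at h
  have hd1 : d = 1 := by exact_mod_cast h.symm
  subst hd1
  exact hd

end Part2

/-! ## Part 3: The `k`-form of the base and complex points over its generic point -/

section Part3

open _root_.CategoryTheory _root_.AlgebraicGeometry TopologicalSpace
open Literature.AlgebraicGeometry.Motives Literature.AlgebraicGeometry.HodgeTheory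

/-! ### The base of a descended family: its `k`-form is irreducible, locally of finite type, and `k`-generic complex points lie over its generic point -/

section Base

variable {k : Type} [Field k] (σ : k →+* ℂ) (S₀ : SchemeOver k)

/-- `Spec ℂ → Spec k` (along `σ`) is surjective, flat and quasi-compact — the fpqc cover along which
properties of `S₀` are read off from `S₀ ⊗_σ ℂ`. [cite: CharlesSchnell2014Notes, Prop. 11.3.11 (proof), auxiliary step] -/
theorem surjective_flat_quasiCompact_specMap :
    (@Surjective ⊓ @Flat ⊓ @QuasiCompact : MorphismProperty Scheme)
      (Spec.map (CommRingCat.ofHom σ)) := by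
  letI := σ.toAlgebra
  haveI : Subsingleton ↥(Spec (CommRingCat.of k)) :=
    inferInstanceAs (Subsingleton (PrimeSpectrum k))
  haveI : Surjective (Spec.map (CommRingCat.ofHom σ)) :=
    ⟨fun x ↦ ⟨(default : ↥(Spec (CommRingCat.of ℂ))), Subsingleton.elim _ _⟩⟩
  haveI : Flat (Spec.map (CommRingCat.ofHom σ)) := by
    rw [HasRingHomProperty.Spec_iff (P := @Flat)]
    change Module.Flat k ℂ
    infer_instance
  exact ⟨⟨inferInstance, inferInstance⟩, inferInstance⟩

/-- **The `k`-form of the base is locally of finite type** when its complexification is smooth over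
`ℂ` (fpqc descent of `LocallyOfFiniteType` along `Spec ℂ → Spec k`, Mathlib `LocalFlatDescent`).
 [cite: CharlesSchnell2014Notes, Prop. 11.3.11 (proof), auxiliary step] -/
theorem locallyOfFiniteType_of_smooth_baseChangeHom
    [AlgebraicGeometry.Smooth ((baseChangeHom σ).obj S₀).hom] : LocallyOfFiniteType S₀.hom := by
  have h1 : LocallyOfFiniteType ((baseChangeHom σ).obj S₀).hom := inferInstance
  exact MorphismProperty.of_pullback_snd_of_descendsAlong (P := @LocallyOfFiniteType)
    (Q := @Surjective ⊓ @Flat ⊓ @QuasiCompact) (f := S₀.hom) (g := Spec.map (CommRingCat.ofHom σ))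
    (surjective_flat_quasiCompact_specMap σ) h1

/-- **The `k`-form of the base is irreducible** when its complexification is: `S₀ ⊗_σ ℂ → S₀` is
surjective (base change of `Spec ℂ → Spec k`) and continuous. [cite: CharlesSchnell2014Notes, Prop. 11.3.11 (proof), auxiliary step] -/
theorem irreducibleSpace_of_baseChangeHom [IrreducibleSpace ((baseChangeHom σ).obj S₀).left] :
    IrreducibleSpace S₀.left := by
  haveI : Surjective (baseChangeHomFst σ S₀) :=
    MorphismProperty.pullback_fst _ _ (surjective_flat_quasiCompact_specMap σ).1.1
  have hsurj : Function.Surjective (baseChangeHomFst σ S₀).base := (baseChangeHomFst σ S₀).surjective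
  have h : IsIrreducible (Set.univ : Set S₀.left) := by
    rw [← Set.image_univ_of_surjective hsurj]
    exact (IrreducibleSpace.isIrreducible_univ _).image _
      (baseChangeHomFst σ S₀).base.hom.continuous.continuousOn
  exact (irreducibleSpace_def _).2 h

/-- **`k`-generic ⟹ over the generic point** (Charles–Schnell, Lemma 11.3.14, for the base of a
descended family): if `S₀ ⊗_σ ℂ` is smooth over `ℂ` with irreducible underlying space and
`s ∈ S(ℂ)` is `k`-generic in Weil's sense (hypothesis `hs`: `s` lies in no proper subset defined over `σ(k)`),
then `s` lies over the generic point of `S₀`. [cite: CharlesSchnell2014Notes, Lemma 11.3.14 (proof)] -/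
theorem base_pt_eq_genericPoint_of_isGenericPoint
    [AlgebraicGeometry.Smooth ((baseChangeHom σ).obj S₀).hom]
    [IrreducibleSpace ((baseChangeHom σ).obj S₀).left]
    {s : ComplexPoints ((baseChangeHom σ).obj S₀)}
    (hs : ∀ Z : Set (ComplexPoints ((baseChangeHom σ).obj S₀)),
      IsDefinedOver σ S₀ σ.fieldRange Z → s ∈ Z → Z = Set.univ) :
    haveI := irreducibleSpace_of_baseChangeHom σ S₀
    (baseChangeHomFst σ S₀).base s.pt = genericPoint S₀.left := by
  haveI := locallyOfFiniteType_of_smooth_baseChangeHom σ S₀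
  haveI := irreducibleSpace_of_baseChangeHom σ S₀
  exact base_pt_eq_genericPoint_of_weilGeneric σ S₀ σ.fieldRange hs

/-- **`k`-generic ⟺ over the generic point**, for `k` countable (the converse direction is Lang's
C4 ⇒ C7 through a generic point, `weilGeneric_of_closure_base_pt_eq_univ`).
[cite: CharlesSchnell2014Notes, Lemma 11.3.14 (proof)] [cite: Lang1958IAG, Ch. III §5, C4–C7] -/
theorem isGenericPoint_iff_base_pt_eq_genericPoint [Countable k]
    [AlgebraicGeometry.Smooth ((baseChangeHom σ).obj S₀).hom]
    [IrreducibleSpace ((baseChangeHom σ).obj S₀).left]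
    (s : ComplexPoints ((baseChangeHom σ).obj S₀)) :
    haveI := irreducibleSpace_of_baseChangeHom σ S₀
    (∀ Z : Set (ComplexPoints ((baseChangeHom σ).obj S₀)),
        IsDefinedOver σ S₀ σ.fieldRange Z → s ∈ Z → Z = Set.univ) ↔
      (baseChangeHomFst σ S₀).base s.pt = genericPoint S₀.left := by
  haveI := locallyOfFiniteType_of_smooth_baseChangeHom σ S₀
  haveI := irreducibleSpace_of_baseChangeHom σ S₀
  exact weilGeneric_fieldRange_iff_base_pt_eq_genericPoint s

end Base

section CurveBase

/-- **An irreducible scheme smooth over `ℂ` is integral** (smooth over a field ⟹ reduced). [cite: CharlesSchnell2014Notes, Prop. 11.3.11 (proof), auxiliary step] -/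
theorem isIntegral_of_irreducibleSpace_of_smooth (S : SchemeOver ℂ) [IrreducibleSpace S.left]
    [AlgebraicGeometry.Smooth S.hom] : IsIntegral S.left := by
  haveI : IsReduced S.left := isReduced_of_smooth_over_field S.hom
  exact isIntegral_of_irreducibleSpace_of_isReduced S.left

end CurveBase

end Part3

/-! ## Part 4: Small helpers -/

section Part4

open _root_.CategoryTheory _root_.CategoryTheory.Limits _root_.AlgebraicGeometry TopologicalSpace
open Literature.AlgebraicGeometry.Motives Literature.AlgebraicGeometry.HodgeTheory

/-! ### Small helpers -/

section Helpers

/-- Quasi-projectivity over `ℂ` is invariant under isomorphisms (an isomorphism followed by an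
open immersion into a projective scheme is an open immersion into it). [cite: CharlesSchnell2014Notes, Prop. 11.3.11 (proof), auxiliary step] -/
theorem isQuasiProjectiveOver_of_iso {X X' : SchemeOver ℂ} (e : X' ≅ X)
    (h : IsQuasiProjectiveOver X) : IsQuasiProjectiveOver X' := by
  obtain ⟨P, j, hP, hj⟩ := h
  haveI := hj
  haveI : IsIso e.hom.left := (inferInstance : IsIso ((Over.forget _).mapIso e).hom)
  refine ⟨P, e.hom ≫ j, hP, ?_⟩
  rw [Over.comp_left]
  infer_instance

/-- A complex point of `S₀ ⊗_σ ℂ` whose image in `S₀` is dense lies over the generic point of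
`S₀`. [cite: CharlesSchnell2014Notes, Prop. 11.3.11 (proof), auxiliary step] -/
theorem base_pt_eq_genericPoint_of_closure_eq {k : Type} [Field k] (σ : k →+* ℂ)
    (S₀ : SchemeOver k) [IrreducibleSpace S₀.left] (s : ComplexPoints ((baseChangeHom σ).obj S₀))
    (hs : closure {(baseChangeHomFst σ S₀).base s.pt} = (Set.univ : Set S₀.left)) :
    baseChangeHomFst σ S₀ s.pt = genericPoint S₀.left := by
  have h : IsGenericPoint (baseChangeHomFst σ S₀ s.pt) (⊤ : Set S₀.left) := hs
  exact h.eq (genericPoint_spec S₀.left)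

end Helpers

end Part4

/-! ## Part 5: Generic points under an integral extension of the field of definition -/

section Part5

open _root_.CategoryTheory _root_.CategoryTheory.Limits _root_.AlgebraicGeometry TopologicalSpace
open Literature.AlgebraicGeometry.Motives Literature.AlgebraicGeometry.HodgeTheory

/-! ### A complex point generic over `k` stays generic over an integral extension of `k` -/

section General

variable {k k' : Type} [Field k] [Field k'] (σ : k →+* ℂ) (σ' : k →+* k') (τ : k' →+* ℂ)

/-- **A complex point generic over `k` stays generic over an integral extension `k'`**: for
`τ ∘ σ' = σ` with `k'` integral over `σ'(k)`, `S₀` a `k`-scheme whose complexification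
`S₀ ⊗_σ ℂ` is irreducible and smooth over `ℂ`, and a complex point `s` of `S₀ ⊗_σ ℂ` over the
generic point of `S₀`, the corresponding complex point `eS⁻¹ s` of `(S₀ ⊗_{σ'} k') ⊗_τ ℂ`
(transitivity of base change) lies over the generic point of `S₀ ⊗_{σ'} k'` (incomparability
along the integral projection `S₀ ⊗ k' → S₀`, Atiyah–Macdonald Cor. 5.9; Charles–Schnell,
Lemma 11.3.14 for the notion of a generic complex point). [cite: AtiyahMacdonald1969, Cor. 5.9]
[cite: CharlesSchnell2014Notes, Lemma 11.3.14] -/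
theorem closure_base_pt_eq_univ_of_factor (hσ' : σ'.IsIntegral) (hτσ : τ.comp σ' = σ)
    (S₀ : SchemeOver k) [IrreducibleSpace ((baseChangeHom σ).obj S₀).left]
    [AlgebraicGeometry.Smooth ((baseChangeHom σ).obj S₀).hom]
    [IrreducibleSpace ((baseChangeHom τ).obj ((baseChangeHom σ').obj S₀)).left]
    [AlgebraicGeometry.Smooth ((baseChangeHom τ).obj ((baseChangeHom σ').obj S₀)).hom]
    (s : ComplexPoints ((baseChangeHom σ).obj S₀))
    (hs : closure {(baseChangeHomFst σ S₀).base s.pt} = (Set.univ : Set S₀.left)) :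
    closure {(baseChangeHomFst τ ((baseChangeHom σ').obj S₀)).base
        (AlgPoints.map (baseChangeHomObjIsoOfComp σ' τ σ hτσ S₀).inv s).pt} =
      (Set.univ : Set ((baseChangeHom σ').obj S₀).left) := by
  haveI : IrreducibleSpace S₀.left := irreducibleSpace_of_baseChangeHom σ S₀
  haveI : IsIntegral ((baseChangeHom σ).obj S₀).left := isIntegral_of_irreducibleSpace_of_smooth _
  haveI : IsIntegral S₀.left := isIntegral_of_baseChangeHom σ S₀
  haveI : IsIntegral ((baseChangeHom τ).obj ((baseChangeHom σ').obj S₀)).left :=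
    isIntegral_of_irreducibleSpace_of_smooth _
  haveI : IsIntegral ((baseChangeHom σ').obj S₀).left :=
    isIntegral_of_baseChangeHom τ ((baseChangeHom σ').obj S₀)
  have e1 : (baseChangeHomObjIsoOfComp σ' τ σ hτσ S₀).inv.left ≫
      baseChangeHomFst τ ((baseChangeHom σ').obj S₀) ≫ baseChangeHomFst σ' S₀ = baseChangeHomFst σ S₀ := by
    rw [← baseChangeHomObjIsoOfComp_hom_left_fst σ' τ σ hτσ S₀, ← Over.comp_left_assoc,
      Iso.inv_hom_id, Over.id_left, Category.id_comp]
  have e2 := congrArg (fun φ => φ.base s.pt) e1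
  simp only [Scheme.Hom.comp_base, TopCat.coe_comp, Function.comp_apply] at e2
  have h1 : baseChangeHomFst σ' S₀ (baseChangeHomFst τ ((baseChangeHom σ').obj S₀)
      (AlgPoints.map (baseChangeHomObjIsoOfComp σ' τ σ hτσ S₀).inv s).pt) = genericPoint S₀.left := by
    rw [AlgPoints.pt_map]
    exact e2.trans (base_pt_eq_genericPoint_of_closure_eq σ S₀ s hs)
  have h2 := eq_genericPoint_of_baseChangeHomFst_eq σ' hσ' S₀ h1
  change closure {baseChangeHomFst τ ((baseChangeHom σ').obj S₀)
    (AlgPoints.map (baseChangeHomObjIsoOfComp σ' τ σ hτσ S₀).inv s).pt} = Set.univ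
  rw [h2]
  exact genericPoint_closure _

end General

end Part5

end Literature.AlgebraicGeometry.HodgeTheory.AlgebraicityLocusPropagation

end
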